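import Mathlib
import Summits.RiemannHypothesis.RiemannHypothesis.Theorems.WeilFarFloorPerturbation
import Summits.RiemannHypothesis.RiemannHypothesis.Theorems.WeilFarFloorCoshTest
import HarnessLib

/-!
# The cosh gap is a perturbation gain: `λ_max(a) ≤ R_c(a) + B²/((a + sinh a)(R_c(a) − Λ₂))`

Helper file (`--supports stmt-RiemannHypothesis-0098`, lead-track anchor: Weil-positivity window ladder, format-C far bound),
pure proofs.  Seat rh-explicit-weil-1 gen10 (memo `run/shared/lean/pub/rh-explicit/rh-explicit-weil-1/FORMAT-K3.md` §11.13–11.15).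
`WeilFarFloorPerturbation` specialised to the cosh test `χ_a = cosh(x/2)·1_{[−a,a]}` of `WeilFarFloorCoshTest` (`∫χ_a² = a + sinh a`,
`Q_a(χ_a) = S(a) = Σ_{n≤e^{2a}} Λ(n)(e^a/n − e^{−a} + (2a − log n)(1 + 1/n)/2)`, quotient `R_c(a) = S(a)/(a + sinh a)`): if the prime-shift form is
bounded by `Λ₂ < R_c(a)` on the orthocomplement of `χ_a` with coupling constant `B` (hypothesis `hcomp`, the spectral-gap-with-margin form C-XV′ of
the upper clause), then **`λ_max(a) ≤ R_c(a) + B²/((a + sinh a)(R_c(a) − Λ₂))`** (`farCoercivityFloor_le_coshQuotient_add`).  Numerically (kit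
j224438/j224682) `B² ≈ 2.3(a + sinh a)` and the bound reproduces the observed cosh gap `≈ 2e^{−a}` to `10⁻⁵`; combined with
`WeilFarFloorCoshZeroSum`/`WeilFarFloorLawIffCoshGap` (under RH) a bounded gain gives law C-XIII and a vanishing gain the sharp law with residual `−Z(a)`.
Standard axioms only.
-/

set_option linter.dupNamespace false
set_option autoImplicit false

noncomputable section

open MeasureTheory Set
open scoped ArithmeticFunction.vonMangoldt

namespace Summit.RiemannHypothesis.RiemannHypothesis.Theorems.WeilFormatC

namespace FloorPerturbation

open Literature.NumberTheory.LFunctions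

/-- **The cosh gap as a perturbation gain.**  For `a > 0`, if for every admissible `w ⊥ χ_a` and every `α`,
`Q_a(αχ_a + w) ≤ α²Q_a(χ_a) + 2|α|B(∫w²)^{1/2} + Λ₂∫w²` with `Λ₂ < R_c(a) = S(a)/(a + sinh a)`, then
`λ_max(a) ≤ R_c(a) + B²/((a + sinh a)(R_c(a) − Λ₂))`. -/
theorem farCoercivityFloor_le_coshQuotient_add {a : ℝ} (ha : 0 < a) {Λ₂ B : ℝ}
    (hΛ : Λ₂ < (∑ n ∈ Finset.Ioc 0 ⌊Real.exp (2 * a)⌋₊,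
          (Λ n : ℝ) * (Real.exp a / n - Real.exp (-a) + (2 * a - Real.log n) * (1 + 1 / n) / 2)) / (a + Real.sinh a))
    (hcomp : ∀ (w : ℝ → ℝ) (Cw α : ℝ), Measurable w → (∀ x, |w x| ≤ Cw) → (∀ x, x ∉ Icc (-a) a → w x = 0) →
      ∫ x, w x * (Icc (-a) a).indicator (fun y ↦ Real.cosh (y / 2)) x = 0 →
      primeShiftForm a (fun x ↦ α * (Icc (-a) a).indicator (fun y ↦ Real.cosh (y / 2)) x + w x)
        ≤ α ^ 2 * primeShiftForm a ((Icc (-a) a).indicator (fun y ↦ Real.cosh (y / 2)))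
          + 2 * |α| * B * Real.sqrt (∫ x, w x ^ 2) + Λ₂ * ∫ x, w x ^ 2) :
    farCoercivityFloor a
      ≤ (∑ n ∈ Finset.Ioc 0 ⌊Real.exp (2 * a)⌋₊,
          (Λ n : ℝ) * (Real.exp a / n - Real.exp (-a) + (2 * a - Real.log n) * (1 + 1 / n) / 2)) / (a + Real.sinh a)
        + B ^ 2 / ((a + Real.sinh a) * ((∑ n ∈ Finset.Ioc 0 ⌊Real.exp (2 * a)⌋₊,
          (Λ n : ℝ) * (Real.exp a / n - Real.exp (-a) + (2 * a - Real.log n) * (1 + 1 / n) / 2)) / (a + Real.sinh a) - Λ₂)) := by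
  obtain ⟨hm, hb, hs⟩ := FloorCosh.coshTest_admissible a
  have hN : ∫ x, (Icc (-a) a).indicator (fun y ↦ Real.cosh (y / 2)) x ^ 2 = a + Real.sinh a :=
    FloorCosh.integral_coshTest_sq ha.le
  have hNpos : 0 < ∫ x, (Icc (-a) a).indicator (fun y ↦ Real.cosh (y / 2)) x ^ 2 := by
    rw [hN]; have := Real.sinh_pos_iff.2 ha; linarith
  have h := farCoercivityFloor_le_quotient_add_of_complement ha hm hb hs hNpos (Λ₂ := Λ₂) (B := B)
    (by rw [FloorCosh.primeShiftForm_coshTest, hN]; exact hΛ) hcomp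
  rw [FloorCosh.primeShiftForm_coshTest, hN] at h
  exact h

/-- **C-XV′ (spectral gap with margin `m`) and the coupling law (`B² ≤ b·(a + sinh a)`) bound the cosh gap by `b/m` — RH-free.**
If eventually (in `a`) the complement/coupling hypothesis of `farCoercivityFloor_le_coshQuotient_add` holds with some `Λ₂ ≤ R_c(a) − m` and
`B² ≤ b(a + sinh a)`, then eventually `λ_max(a) − R_c(a) ≤ b/m`.  (Numerically `b ≈ 2.3`; with `WeilFarFloorLawIffCoshGap` this gives law C-XIII
under RH, and a margin `m(a) → ∞` gives the sharp law with residual `−Z(a)`.) -/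
theorem eventually_coshGap_le_of_spectralGap {m b : ℝ} (hm : 0 < m)
    (h : ∀ᶠ a : ℝ in Filter.atTop, ∃ Λ₂ B : ℝ,
      Λ₂ ≤ (∑ n ∈ Finset.Ioc 0 ⌊Real.exp (2 * a)⌋₊,
          (Λ n : ℝ) * (Real.exp a / n - Real.exp (-a) + (2 * a - Real.log n) * (1 + 1 / n) / 2)) / (a + Real.sinh a) - m ∧
      B ^ 2 ≤ b * (a + Real.sinh a) ∧
      ∀ (w : ℝ → ℝ) (Cw α : ℝ), Measurable w → (∀ x, |w x| ≤ Cw) → (∀ x, x ∉ Icc (-a) a → w x = 0) →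
        ∫ x, w x * (Icc (-a) a).indicator (fun y ↦ Real.cosh (y / 2)) x = 0 →
        primeShiftForm a (fun x ↦ α * (Icc (-a) a).indicator (fun y ↦ Real.cosh (y / 2)) x + w x)
          ≤ α ^ 2 * primeShiftForm a ((Icc (-a) a).indicator (fun y ↦ Real.cosh (y / 2)))
            + 2 * |α| * B * Real.sqrt (∫ x, w x ^ 2) + Λ₂ * ∫ x, w x ^ 2) :
    ∀ᶠ a : ℝ in Filter.atTop, farCoercivityFloor a
      - (∑ n ∈ Finset.Ioc 0 ⌊Real.exp (2 * a)⌋₊,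
          (Λ n : ℝ) * (Real.exp a / n - Real.exp (-a) + (2 * a - Real.log n) * (1 + 1 / n) / 2)) / (a + Real.sinh a)
      ≤ b / m := by
  filter_upwards [h, Filter.eventually_gt_atTop (0 : ℝ)] with a ha hapos
  obtain ⟨Λ₂, B, hΛ, hB, hcomp⟩ := ha
  set R := (∑ n ∈ Finset.Ioc 0 ⌊Real.exp (2 * a)⌋₊,
      (Λ n : ℝ) * (Real.exp a / n - Real.exp (-a) + (2 * a - Real.log n) * (1 + 1 / n) / 2)) / (a + Real.sinh a) with hR
  have hD : 0 < a + Real.sinh a := by have := Real.sinh_pos_iff.2 hapos; linarith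
  have hgap : m ≤ R - Λ₂ := by linarith
  have hRΛ : 0 < R - Λ₂ := lt_of_lt_of_le hm hgap
  have hmain := farCoercivityFloor_le_coshQuotient_add hapos (Λ₂ := Λ₂) (B := B) (by rw [← hR]; linarith) hcomp
  rw [← hR] at hmain
  -- gain `B²/((a + sinh a)(R − Λ₂)) ≤ b(a + sinh a)/((a + sinh a)·m) = b/m`
  have hb : 0 ≤ b := by
    have h1 : 0 ≤ b * (a + Real.sinh a) := (sq_nonneg B).trans hB
    exact nonneg_of_mul_nonneg_left h1 hD
  have hgain : B ^ 2 / ((a + Real.sinh a) * (R - Λ₂)) ≤ b / m := by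
    rw [div_le_div_iff₀ (mul_pos hD hRΛ) hm]
    calc B ^ 2 * m ≤ b * (a + Real.sinh a) * m := by nlinarith
      _ ≤ b * ((a + Real.sinh a) * (R - Λ₂)) := by nlinarith [mul_nonneg hb hD.le]
  linarith

end FloorPerturbation

end Summit.RiemannHypothesis.RiemannHypothesis.Theorems.WeilFormatC
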